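import Summits.BirchSwinnertonDyer.Rank1Residual.Additive.RamifiedSevenGenusCarrierAlgebra
import Summits.BirchSwinnertonDyer.Rank1Residual.Additive.KatoDescentIntegralH1RankOne
import HarnessLib

set_option autoImplicit false

/-!
# `𝒞₇` genus road (crux `EllipticUnitValueSevenOfGZK`, K7r), row K2C-6 = CARRIER-1, block (C2): the ★-COLUMN of the
# pinned Kato frame — `zOne`, `k`, `zOne_pos` FROM the fact ★ under GZK at a `𝒞₇` member, and the definitional
# «GIVEN ★» placement `zeta = zS := 7^{−k}·j(zOne)` in `A = 𝐇¹_{K,Γ}(T₇W_K)[1/7]` (`u := 1`, `a := 0`, `t := 1`) with the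
# field letters `j_zOne`, `zeta_eq`, `a_le_one` as THEOREMS — no structure, no def, no new fact

Cell `bsd-cm`, seat `bsd-cm-prr-ty1` g34 (literature-prover), SUMMON `wake/SUMMON-bsd-cm-prr-ty1-20260830T2355Z.md`
(c73b963b3a51998d; planner D1000 (C), ruling on flag (F1)), scoping memo `bsd-cm-prr-ty1/g33/CarrierColumn-scope.md`
(c1ed60c7a00cd5c2) §1 row (C2), CHECK (CAR-2) on the cell STATUS (2026-08-31).  Crux `stmt-BirchSwinnertonDyer-19945`
(route K7r), skeleton zp v16 `Cruxes/EllipticUnitValueSevenOfGZK/Lines/kato_perrin_riou_zp.lean` (bb91f352028468bc), K2ᶜ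
input stub `stub_integralComparisonInputsSeven` (antecedents `★ → GZK → ∀ W ∈ 𝒞₇ …`).  Companion of (C1)
`RamifiedSevenGenusCarrierAlgebra.lean` (the carriers `R = Λ[ϖ]/(ϖ² + 7)`, `A = IK.ratH`, `ιS`, `j = ιS ∘ res`).
HONEST LABEL: this file serves eleven fields of a hypothesis structure from ONE existing named fact (★) and GZK; it
constructs no `PinnedKatoGenusFrame`, closes no stub; stmt-BirchSwinnertonDyer-19945 is OPEN (4 sorries); K2ᶜ
inhabitation is NOT done; `X12.CMRamifiedSeven` is NOT proved; no summit statement is proved by this seat; BSD is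
claimed for no curve.

## The ★ binder as consumed (CHECK (CAR-2) (i))

`hstar : Kato2004.exists_zetaClassPosition_of_rank_le_one` (`ZetaClassOnRankLeOneBranch.lean` §4: Kato Thm. 12.5 (1)(2),
§13.9, Lemma 13.10 (1) on the `Δ`-trivial branch under «`rank_Λ 𝐇¹_Γ(T₇W) ≤ 1`»; the EXISTING cite-tagged fact of the
stub's print ledger, no new debt) and `hGZK : rank_eq_analyticRank_of_analyticRank_le_one`.  At `W ∈ 𝒞₇`
(`X12.ClassCSeven W`: `r_an(W) = 1`): GZK gives `rank W(ℚ) = 1` and `Ш(W)` finite, (R1) `LocPKummer.rank_integralH1_le_one`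
(`KatoDescentIntegralH1RankOne.lean`, Kato (14.9.3) ⊗ ℚ) gives `rank_{ℤ₇} H¹(ℤ[1/7], T₇W) ≤ 1`, and ★'s corollary
`of_rank_integralH1_le_one` gives the uniform position `∃ (zOne : I.H) (k : ℕ), ZetaClassPosition W 7 K hK I k zOne` on
EVERY pin `I` over the cyclotomic datum — `exists_zetaClassPosition_of_classCSeven` (the derivation of (B4)
`exists_isAdmissibleZetaClass_of_classCSeven`, p774837, without its μ-free steps).

## The definitional «GIVEN ★» placement (pen ruling on flag (F1)) and what turns VACUOUS (CHECK (CAR-2) (iii))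

With `A = 𝐇¹_{K,Γ}(T₇W_K)[1/7]` the class `zS := res(zOne)/7^k = LocalizedModule.mk (I.resOver IK hγ hγK zOne) ⟨7^k, _⟩`
EXISTS in `A` (`7` is inverted), and `u := 1`, `a := 0`, `t := 1`, `frame.zeta := zS`.  Then the field letters read:
`j_zOne : j zOne = 7^k • (1 • π^0 • zS)` (= (C1) `pow_smul_mk_resOver_pow`), `zeta_eq : zeta = 1 • zS`, `a_le_one : 0 ≤ 1`.
VACUOUS BY CONSTRUCTION (said here as the pen asked): the lattice lemma (L3) «`𝐳_{γ_W} = u·π^{a}·𝐳_{γ_{S′_W}⁺}`, `a = a_W ∈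
{0,1}` the member's position in the split hull» (`zW = zS`) and §5 «`𝐳_{γ′} = t·zS`, `t = ½`» (`t = 1`) carry NO content
for this `zeta`; their content — Kato's `a_W` and the `½` — MIGRATES into the kernel (C4) `ResidueIsGenusUnitClassShape Φ`
= «`EU_𝔟 ∈ Λ_O·(7^{−k}·res zOne)` with an INTEGRAL constant», which must now absorb `π^{a_W}` and `t` — i.e. Kato's
`a_W ∈ {0,1}` and the `½` now live ENTIRELY in (C4b).  Likewise the K2ᶜ input-form conjunct `∃ (t' : Φ.R) (m₀ : ℕ),
Φ.t * t' = Φ.π ^ m₀` (zp v16 l.549, the gauge co-factor (ht′)) is `⟨1, 0, by simp⟩` under `t := 1`.  A contentful (L3)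
needs Kato's `𝐳_{γ′}` AT THE SPLIT HULL (`V(f)` and the `z`-map: the R3C (m1) vocabulary gap) and is NOT claimed.  NOT
vacuous: `zOne_pos` (★'s uniform VALUE position — the tie to Kato's values (12.5 (1)) through the tree's
`ZetaClassPosition`), `j_zOne` as a FACTORISATION through the one structure map `ιS` (it is what excludes the rescaled
cheap inhabitant (b) of `RamifiedSevenGenusKatoPinnedFrame.lean` docstring l.69–73), `torsionFree_π` ((C1), unconditional).

## References

[cite: Kato2004Asterisque, Thm. 12.5 (1) (p. 221), §13.9 (p. 230, "z_γ^{(p)} is independent of the choices"), Thm. 12.4 (2) (p. 222), §14.9 (14.9.3) (p. 240), 15.14 (p. 264), §15.11 (15.11.3) (pp. 261–262)]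
— K. Kato, Astérisque 295 (2004); [cite: Darmon2004, Thm. 3.22] (GZK); [cite: AtiyahMacdonald1969, Ch. 3, pp. 38–39]
(`S⁻¹M`).  Tree: ★ `ZetaClassOnRankLeOneBranch.lean` (p768858), (R1) `KatoDescentIntegralH1RankOne.lean`, (B4) p774837,
(C1) `RamifiedSevenGenusCarrierAlgebra.lean`.
-/

noncomputable section

open scoped NumberField
open Field
open Literature.NumberTheory.GaloisRepresentations
open Literature.NumberTheory.EllipticCurves
open Literature.NumberTheory.EllipticCurves.Kato2004
open Summit.BirchSwinnertonDyer.Rank1Residual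

namespace Summit.BirchSwinnertonDyer.Rank1Residual.Additive.GenusSeven.StarColumn

/-! ## §1 Fields `zOne`, `k`, `zOne_pos` from ★ and GZK at a `𝒞₇` member (∃-package) -/

/-- **★ at a `𝒞₇` member: a uniform-position witness on every pin.**  Under ★ and GZK, for `W ∈ 𝒞₇` (`r_an = 1` ⇒
`rank W(ℚ) = 1`, `Ш(W)` finite ⇒ `rank_{ℤ₇} H¹(ℤ[1/7], T₇W) ≤ 1` by (R1)), every cyclotomic datum `(K, hK, γ, hγ)` and every
pin `I : IwasawaH1Data W 7 K γ` carry `zOne ∈ I.H`, `k : ℕ` in uniform position `ZetaClassPosition W 7 K hK I k zOne`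
(«`zOne = 7^k·𝐳_{γ_W}` w.r.t. every value-pinned realised family») — the frame fields `zOne`, `k`, `zOne_pos`.
CONDITIONAL on the two displayed hypotheses; nothing asserted.
[cite: Kato2004Asterisque, Thm. 12.5 (1) (p. 221), Thm. 12.4 (2) (p. 222), §14.9 (14.9.3) (p. 240)] [cite: Darmon2004, Thm. 3.22] -/
theorem exists_zetaClassPosition_of_classCSeven (hstar : exists_zetaClassPosition_of_rank_le_one)
    (hGZK : rank_eq_analyticRank_of_analyticRank_le_one)
    (W : WeierstrassCurve ℚ) [W.IsElliptic] [W.IsGloballyMinimal] [Fact (Nat.Prime 7)] (hC : X12.ClassCSeven W)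
    [ContinuousSMul ℤ_[7] (W.tateModule 7)] {K : ZpExtension ℚ 7} (hK : K.IsCyclotomic)
    {γ : absoluteGaloisGroup ℚ} (hγ : K.IsTopGenerator γ) (I : IwasawaH1Data W 7 K γ) :
    ∃ (zOne : I.H) (k : ℕ), ZetaClassPosition W 7 K hK I k zOne := by
  have hr : W.analyticRank = 1 := hC.2.2.1
  have hrank : W.mordellWeilRank = 1 := by rw [(hGZK W hr.le).1, hr]
  haveI : Finite W.sha := (hGZK W hr.le).2
  have hsha : Finite (AddCommGroup.primaryComponent W.sha 7) := inferInstance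
  exact hstar.of_rank_integralH1_le_one hK hγ (by decide) I (LocPKummer.rank_integralH1_le_one W 7 K hrank hsha)

/-! ## §2 Fields `zS`, `u`, `a`, `a_le_one`, `t`, `frame.zeta`, `zeta_eq`, `j_zOne` over the (C1) carriers -/

section Placement

variable {Kcm : Type} [Field Kcm] [NumberField Kcm] (h2 : Module.finrank ℚ Kcm = 2)
  (W : WeierstrassCurve ℚ) [W.IsElliptic] [ContinuousSMul ℤ_[7] (W.tateModule 7)]
  [ContinuousSMul ℤ_[7] ((W.baseChange Kcm).tateModule 7)]
  (K : ZpExtension ℚ 7) {γ : absoluteGaloisGroup ℚ} (I : IwasawaH1Data W 7 K γ) (hγ : K.IsTopGenerator γ)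
  {γK : absoluteGaloisGroup Kcm}
  (IK : IwasawaH1DataOver (W.baseChange Kcm) 7 (K.restrictOfFinrankEqTwo (by decide) Kcm h2) γK)
  (hγK : (K.restrictOfFinrankEqTwo (by decide) Kcm h2).IsTopGenerator γK)
  (φ : WeierstrassCurve.Isogeny (W.baseChange Kcm) (W.baseChange Kcm))
  (φ_sq : ∀ P, φ (φ P) = (-7 : ℤ) • P) (zOne : I.H) (k : ℕ)

/-- **Field `j_zOne`** at `zS := res(zOne)/7^k`, `u := 1`, `a := 0` (letter of KatoShapes l.201 with these values):
`j zOne = 7^k • (1 • π^0 • zS)` in `A = 𝐇¹[1/7]` — (C1) `pow_smul_mk_resOver_pow` after `1 • π⁰ • zS = zS`.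
[cite: Kato2004Asterisque, Thm. 12.5 (1) (p. 221) and §13.9 (p. 230)] [cite: AtiyahMacdonald1969, Ch. 3, pp. 38–39] -/
theorem j_zOne :
    letI := IK.cmModuleRat hγK φ φ_sq
    (LocalizedModule.mkLinearMap (Submonoid.powers (7 : IwasawaAlgebra 7)) IK.H ∘ₗ I.resOver IK hγ hγK) zOne =
      ((7 : IwasawaAlgebra 7) ^ k) •
        ((((1 : (QuadOrder (IwasawaAlgebra 7) (-7))ˣ) : (QuadOrder (IwasawaAlgebra 7) (-7))ˣ) :
            QuadOrder (IwasawaAlgebra 7) (-7)) •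
          (QuadOrder.ϖ : QuadOrder (IwasawaAlgebra 7) (-7)) ^ (0 : ℕ) •
            (LocalizedModule.mk (I.resOver IK hγ hγK zOne)
              (⟨(7 : IwasawaAlgebra 7) ^ k, k, rfl⟩ : Submonoid.powers (7 : IwasawaAlgebra 7)) : IK.ratH)) := by
  letI := IK.cmModuleRat hγK φ φ_sq
  rw [Units.val_one, one_smul, pow_zero, one_smul]
  exact (CarrierAlgebra.pow_smul_mk_resOver_pow h2 W K I hγ IK hγK k zOne).symm

/-- **Field `zeta_eq`** at `frame.zeta := zS`, `t := 1`: `zeta = 1 • zS`. [cite: Kato2004Asterisque, §15.11 (15.11.3) (pp. 261–262)] -/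
theorem zeta_eq :
    letI := IK.cmModuleRat hγK φ φ_sq
    (LocalizedModule.mk (I.resOver IK hγ hγK zOne)
        (⟨(7 : IwasawaAlgebra 7) ^ k, k, rfl⟩ : Submonoid.powers (7 : IwasawaAlgebra 7)) : IK.ratH) =
      (1 : QuadOrder (IwasawaAlgebra 7) (-7)) •
        (LocalizedModule.mk (I.resOver IK hγ hγK zOne)
          (⟨(7 : IwasawaAlgebra 7) ^ k, k, rfl⟩ : Submonoid.powers (7 : IwasawaAlgebra 7)) : IK.ratH) := by
  letI := IK.cmModuleRat hγK φ φ_sq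
  exact (one_smul _ _).symm

/-- `7^k • zS = j zOne` (the placement read forwards: `zS` is `7^{−k}·res(zOne)` in `𝐇¹[1/7]`).
[cite: Kato2004Asterisque, §13.9 (p. 230, "z_γ^{(p)} ∈ 𝐇¹ ⊗ ℚ")] -/
theorem pow_smul_zS :
    ((7 : IwasawaAlgebra 7) ^ k) •
        (LocalizedModule.mk (I.resOver IK hγ hγK zOne)
          (⟨(7 : IwasawaAlgebra 7) ^ k, k, rfl⟩ : Submonoid.powers (7 : IwasawaAlgebra 7)) : IK.ratH) =
      (LocalizedModule.mkLinearMap (Submonoid.powers (7 : IwasawaAlgebra 7)) IK.H ∘ₗ I.resOver IK hγ hγK) zOne :=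
  CarrierAlgebra.pow_smul_mk_resOver_pow h2 W K I hγ IK hγK k zOne

end Placement

/-- **Field `a_le_one`** at `a := 0`: `0 ≤ 1`. [cite: Kato2004Asterisque, §15.11 (2) (pp. 261–262, the member in the split hull)] -/
theorem a_le_one : (0 : ℕ) ≤ 1 :=
  Nat.zero_le 1

/-! ## §3 The ★-column as ONE ∃-package over the (C1) carriers -/

/-- **THE ★-COLUMN (fields `zOne`, `k`, `zOne_pos`, `j_zOne` at `zS := res(zOne)/7^k`, `u := 1`, `a := 0`)**: under ★ and
GZK, for `W ∈ 𝒞₇`, every cyclotomic datum, every `ℚ`-side pin `I` and every `K`-side carrier datum `(Kcm, IK, hγK, φ)` of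
(C1), there are `zOne ∈ I.H`, `k : ℕ` with `ZetaClassPosition W 7 K hK I k zOne` AND the placement identity
`j zOne = 7^k • (1 • π^0 • (res zOne / 7^k))` in `A = 𝐇¹[1/7]`.  CONDITIONAL on ★ and GZK; nothing asserted.
[cite: Kato2004Asterisque, Thm. 12.5 (1) (p. 221), §13.9 (p. 230), 15.14 (p. 264)] [cite: Darmon2004, Thm. 3.22] -/
theorem exists_star_column (hstar : exists_zetaClassPosition_of_rank_le_one)
    (hGZK : rank_eq_analyticRank_of_analyticRank_le_one)
    (W : WeierstrassCurve ℚ) [W.IsElliptic] [W.IsGloballyMinimal] [Fact (Nat.Prime 7)] (hC : X12.ClassCSeven W)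
    [ContinuousSMul ℤ_[7] (W.tateModule 7)] {K : ZpExtension ℚ 7} (hK : K.IsCyclotomic)
    {γ : absoluteGaloisGroup ℚ} (hγ : K.IsTopGenerator γ) (I : IwasawaH1Data W 7 K γ)
    {Kcm : Type} [Field Kcm] [NumberField Kcm] (h2 : Module.finrank ℚ Kcm = 2)
    [ContinuousSMul ℤ_[7] ((W.baseChange Kcm).tateModule 7)] {γK : absoluteGaloisGroup Kcm}
    (IK : IwasawaH1DataOver (W.baseChange Kcm) 7 (K.restrictOfFinrankEqTwo (by decide) Kcm h2) γK)
    (hγK : (K.restrictOfFinrankEqTwo (by decide) Kcm h2).IsTopGenerator γK)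
    (φ : WeierstrassCurve.Isogeny (W.baseChange Kcm) (W.baseChange Kcm)) (φ_sq : ∀ P, φ (φ P) = (-7 : ℤ) • P) :
    ∃ (zOne : I.H) (k : ℕ), ZetaClassPosition W 7 K hK I k zOne ∧
      (letI := IK.cmModuleRat hγK φ φ_sq;
        (LocalizedModule.mkLinearMap (Submonoid.powers (7 : IwasawaAlgebra 7)) IK.H ∘ₗ I.resOver IK hγ hγK) zOne =
          ((7 : IwasawaAlgebra 7) ^ k) •
            ((((1 : (QuadOrder (IwasawaAlgebra 7) (-7))ˣ) : (QuadOrder (IwasawaAlgebra 7) (-7))ˣ) :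
                QuadOrder (IwasawaAlgebra 7) (-7)) •
              (QuadOrder.ϖ : QuadOrder (IwasawaAlgebra 7) (-7)) ^ (0 : ℕ) •
                (LocalizedModule.mk (I.resOver IK hγ hγK zOne)
                  (⟨(7 : IwasawaAlgebra 7) ^ k, k, rfl⟩ : Submonoid.powers (7 : IwasawaAlgebra 7)) : IK.ratH))) := by
  obtain ⟨zOne, k, hpos⟩ := exists_zetaClassPosition_of_classCSeven hstar hGZK W hC hK hγ I
  exact ⟨zOne, k, hpos, j_zOne h2 W K I hγ IK hγK φ φ_sq zOne k⟩

end Summit.BirchSwinnertonDyer.Rank1Residual.Additive.GenusSeven.StarColumn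

end
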